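import Summits.BirchSwinnertonDyer.BirchSwinnertonDyer.Theorems.ErratumRoadFiveEulerHalfNotRamTateComponentPlaces
import Summits.BirchSwinnertonDyer.BirchSwinnertonDyer.Theorems.ErratumRoadFiveEulerHalfNotRamTateComponentSplitPlace
import Summits.BirchSwinnertonDyer.BirchSwinnertonDyer.Theorems.ErratumRoadFiveAuxNormReceptacleDefs
import Literature.NumberTheory.EllipticCurves.RingClassFieldConjugation
import HarnessLib

/-!
# ErratumRoadFive, crux `EulerHalfNotRamNoInertSetAtFive` (stmt-BirchSwinnertonDyer-19715), line `birth` v15 «birth ⊕ aux_norm»: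
# the leaf stub S1 — `stub_tateComponentFamilyLinear` (the Tate component characters on the CM tower at a K-split
# multiplicative prime, K-linear form) — ASSEMBLED from F1 (local character) and F2 (global → local bridges)

Cell `bsd-stepL`, width seat `bsd-line-er5-p1-w3` g6. THEOREMS ONLY (no definition, no named fact, no `sorry`);
`--supports stmt-BirchSwinnertonDyer-19715`. HONEST FRAMING: this proves the stub text
`AuxNormReceptacle.TateComponentFamilyLinear W K ι q` (LEAD er5-p1 g3's Defs module, ideator bsd-idea-9 g9's v5 text) under the
stub's hypotheses; it does NOT close 19715 by itself (the v15 skeleton has two further leaves, (C) and (O)); item 27982 untouched; no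
summit statement is proved; BSD is proved for no curve.

## Construction

`c := ord_q Δ_min(W)`. For a level `n ≥ 1` prime to `q` and a place `w ∋ q` of `K[n]`, let `v := w ∩ 𝓞_K` (a place of `K` above `q`;
`q` is K-split), choose a `K`-embedding `e_w : K[n] → K̄` cutting out `w` through the chosen `K̄ → K̄_v`
(`exists_algHom_isEquiv_of_under_eq`), and set
`comp n w := cast ∘ comp_v ∘ (E(K[n]) → E(K̄) → E(K̄_v))` — `comp_v : Dom_v →+ ZMod (ord_v Δ_min(W ⊗ K))` the local Tate component
character of `TateComponent.exists_componentHom_localPoints` (F1b, p643753; well defined on the push-forward since `K[n]/K` is unramified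
at `v ∤ n`, `smul_pointsMap_map_eq_self_of_mem_inertia`, p644863), `cast : ZMod (ord_v Δ_min(W ⊗ K)) ≃ ZMod c` by
`splitPlace_localData` (p645245). The value does not depend on the embedding cutting out `w` (`exists_resGal_apply_eq_of_isEquiv` +
`pointsMap_map_eq_smul_of_forall_apply_eq`, p645702, with the `Γ_{K_v}`-invariance (4) of F1b) — `comp_spec`. Then (K1) is the kernel
clause (3) of F1b read through JET's G-rec (`pointsMap_map_mem_E0Receptacle_iff`); (K2) extends the embedding of `K[n₀]` to `K[n]`
(`IsAlgClosed.lift`) and uses `comp_spec`; (K3) uses `isEquiv_comap_comp_algEquiv` (`e_w ∘ τ` cuts out `τ⁻¹ w`) and `comp_spec`.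

References (locators only): [cite: SilvermanATAEC1994, IV Cor. 9.2 (d), V Thm. 3.1] [cite: SilvermanAEC2009, VII.§2 Prop. 2.1]
[cite: NeukirchANT1999, Ch. II (8.1), §9 (9.6)] [cite: Cox2013, §9.A] [cite: GrossLMS1991, §4 (𝒢_n)].
-/

set_option linter.dupNamespace false

noncomputable section

open scoped Classical NNReal Pointwise
open NumberField IsDedekindDomain Field WeierstrassCurve

namespace Summit.BirchSwinnertonDyer.BirchSwinnertonDyer.Theorems.TateComponent

open Literature.NumberTheory.EllipticCurves Literature.NumberTheory.GaloisRepresentations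
  IsDedekindDomain.HeightOneSpectrum Summit.BirchSwinnertonDyer.Rank1Residual.X11b
  Literature.NumberTheory.Automorphic Summit.BirchSwinnertonDyer.BirchSwinnertonDyer.Theorems.AuxNormReceptacle

variable {K : Type} [Field K] [NumberField K]

omit [NumberField K] in
/-- If the rational prime `q ∈ v` does not divide `n`, then `n ∉ v`. [folklore] -/
private theorem natCast_not_mem_of_not_dvd {q n : ℕ} (hq : q.Prime) (hqn : ¬ q ∣ n)
    (v : HeightOneSpectrum (𝓞 K)) (hqv : ((q : ℕ) : 𝓞 K) ∈ v.asIdeal) : ((n : ℕ) : 𝓞 K) ∉ v.asIdeal := by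
  intro hn
  obtain ⟨a, b, hab⟩ : IsCoprime (q : ℤ) (n : ℤ) :=
    Nat.isCoprime_iff_coprime.mpr ((Nat.Prime.coprime_iff_not_dvd hq).mpr hqn)
  have h1 : ((a * q + b * n : ℤ) : 𝓞 K) ∈ v.asIdeal := by
    push_cast
    exact v.asIdeal.add_mem (v.asIdeal.mul_mem_left _ hqv) (v.asIdeal.mul_mem_left _ hn)
  rw [hab, Int.cast_one] at h1
  exact v.isPrime.ne_top ((Ideal.eq_top_iff_one _).mpr h1)

set_option maxHeartbeats 3200000 in
/-- **Stub S1 (K-linear form) of line `birth` v15 / `aux_norm_receptacle` v5: the Tate component characters on the CM tower at a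
K-split multiplicative prime.** For `W/ℚ` globally minimal and elliptic, `K` imaginary quadratic with its ring class tower
`K[n] ⊂ ℂ`, a rational prime `q` at which `W` has split multiplicative reduction and which splits in `K` (`#primesOver (q) (𝓞 K) = 2`):
there is a family `comp n w : E(K[n]) →+ ℤ/ord_q Δ_min` over the levels `n ≥ 1` prime to `q` and the places `w ∋ q` of `K[n]` whose
kernel is `E₀(K[n])_w` (K1), compatible with the inclusions `K[n₀] → K[n]` (K2) and covariant under `𝒢_n = Gal(K[n]/K)` (K3).
Assembled from the local Tate component character at the places of `K` above `q` (Silverman ATAEC IV.9.2 (d) on the Tate normal form,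
Matsuno 2009 L4.1's Galois invariance) and the correspondence places ↔ embeddings (Neukirch II (8.1), (9.6)).
[cite: SilvermanATAEC1994, IV Cor. 9.2 (d)] [cite: NeukirchANT1999, Ch. II (8.1), §9 (9.6)] [cite: Cox2013, §9.A] -/
theorem stub_tateComponentFamilyLinear (W : WeierstrassCurve ℚ) [W.IsElliptic] [W.IsGloballyMinimal] (K : Type) [Field K]
    [NumberField K] (ι : K →+* ℂ) [∀ j : ℕ, NumberField (ringClassField K ι j)] (hK : IsImaginaryQuadratic K)
    (q : ℕ) [Fact q.Prime] (hs : W.HasSplitMultiplicativeReductionAtPrime q)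
    (hq2 : ((Ideal.span {(q : ℤ)}).primesOver (𝓞 K)).ncard = 2) :
    Summit.BirchSwinnertonDyer.BirchSwinnertonDyer.Theorems.AuxNormReceptacle.TateComponentFamilyLinear W K ι q := by
  unfold Summit.BirchSwinnertonDyer.BirchSwinnertonDyer.Theorems.AuxNormReceptacle.TateComponentFamilyLinear
  have hq : q.Prime := Fact.out
  haveI : (W.baseChange K).IsElliptic := inferInstanceAs (W.map (algebraMap ℚ K)).IsElliptic
  -- §0 local data at the places `v ∋ q` of `K`
  have hloc : ∀ (v : HeightOneSpectrum (𝓞 K)), ((q : ℕ) : 𝓞 K) ∈ v.asIdeal →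
      ∃ (Dom : AddSubgroup (localPoints (W.baseChange K) (v.adicCompletion K)))
        (cv : Dom →+ ZMod (padicValInt q W.minimalDiscriminantInt)),
        (∀ {𝔐 : Ideal v.localAbsIntegers}, 𝔐 ∈ v.localPrimesAbove →
          ∀ P : localPoints (W.baseChange K) (v.adicCompletion K),
            (∀ τ ∈ 𝔐.inertia (absoluteGaloisGroup (v.adicCompletion K)), τ • P = P) → P ∈ Dom) ∧
        (∀ P (hP : P ∈ Dom), cv ⟨P, hP⟩ = 0 ↔ P ∈ E0Receptacle (W.baseChange K) v) ∧
        (∀ (σ : absoluteGaloisGroup (v.adicCompletion K)) (P) (hP : P ∈ Dom),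
          ∃ hσP : σ • P ∈ Dom, cv ⟨σ • P, hσP⟩ = cv ⟨P, hP⟩) := by
    intro v hqv
    obtain ⟨-, hsK, hord⟩ := splitPlace_localData W hK hq2 hs v hqv
    obtain ⟨Dom, comp, h1, -, h3, h4, -, -⟩ := exists_componentHom_localPoints (W.baseChange K) v hsK
    refine ⟨Dom, AddMonoidHom.mk' (fun x ↦ ZMod.ringEquivCongr hord (comp x)) (fun a b ↦ by rw [map_add, map_add]),
      h1, fun P hP ↦ ?_, fun σ P hP ↦ ?_⟩
    · change ZMod.ringEquivCongr hord (comp ⟨P, hP⟩) = 0 ↔ _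
      rw [map_eq_zero_iff _ (ZMod.ringEquivCongr hord).injective]
      exact h3 P hP
    · obtain ⟨hσP, hval⟩ := h4 σ P hP
      exact ⟨hσP, by
        change ZMod.ringEquivCongr hord (comp ⟨σ • P, hσP⟩) = ZMod.ringEquivCongr hord (comp ⟨P, hP⟩)
        rw [hval]⟩
  choose Dom cv hDomI hker hGal using hloc
  -- the push-forward `E(K[m]) → E(K̄) → E(K̄_v)` along a `K`-embedding
  let Eemb : (v : HeightOneSpectrum (𝓞 K)) → (m : ℕ) → (ringClassField K ι m →ₐ[K] AlgebraicClosure K) →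
      ((W.baseChange (ringClassField K ι m)).toAffine.Point →+ localPoints (W.baseChange K) (v.adicCompletion K)) :=
    fun v m e ↦ (pointsMap (W.baseChange K) (v.adicCompletion K)).comp (Affine.Point.map (W' := W) (e.restrictScalars ℚ))
  have hEemb : ∀ v m (e : ringClassField K ι m →ₐ[K] AlgebraicClosure K) P, Eemb v m e P =
      pointsMap (W.baseChange K) (v.adicCompletion K) (Affine.Point.map (W' := W) (e.restrictScalars ℚ) P) :=
    fun _ _ _ _ ↦ rfl
  -- the push-forward of `E(K[m])`, `m ≥ 1`, `q ∤ m`, lands in `Dom_v`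
  have hmem : ∀ (v : HeightOneSpectrum (𝓞 K)) (hqv : ((q : ℕ) : 𝓞 K) ∈ v.asIdeal) {m : ℕ} (hm : m ≠ 0) (hqm : ¬ q ∣ m)
      (e : ringClassField K ι m →ₐ[K] AlgebraicClosure K) (P : (W.baseChange (ringClassField K ι m)).toAffine.Point),
      Eemb v m e P ∈ Dom v hqv := by
    intro v hqv m hm hqm e P
    obtain ⟨𝔐, h𝔐⟩ := localPrimesAbove_nonempty (v := v)
    exact hDomI v hqv h𝔐 _ fun τ hτ ↦
      smul_pointsMap_map_eq_self_of_mem_inertia hK ι hm e (natCast_not_mem_of_not_dvd hq hqm v hqv) h𝔐 hτ W P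
  -- the place of `K` below a place `w ∋ q` of `K[n]` contains `q`
  have hunder : ∀ {m : ℕ} (w : HeightOneSpectrum (𝓞 (ringClassField K ι m))),
      ((q : ℕ) : 𝓞 (ringClassField K ι m)) ∈ w.asIdeal → ((q : ℕ) : 𝓞 K) ∈ (w.under (𝓞 K)).asIdeal := by
    intro m w hw
    change algebraMap (𝓞 K) (𝓞 (ringClassField K ι m)) (q : 𝓞 K) ∈ w.asIdeal
    rwa [map_natCast]
  -- §1 the character at `(n, w)`, with its independence of the embedding (`comp_spec`)
  have hφ : ∀ (n : ℕ) (hn : n ≠ 0) (hqn : ¬ q ∣ n) (w : HeightOneSpectrum (𝓞 (ringClassField K ι n)))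
      (hw : ((q : ℕ) : 𝓞 (ringClassField K ι n)) ∈ w.asIdeal),
      ∃ φ : (W.baseChange (ringClassField K ι n)).toAffine.Point →+ ZMod (padicValInt q W.minimalDiscriminantInt),
        ∀ (v : HeightOneSpectrum (𝓞 K)) (hqv : ((q : ℕ) : 𝓞 K) ∈ v.asIdeal), w.under (𝓞 K) = v →
          ∀ (e : ringClassField K ι n →ₐ[K] AlgebraicClosure K),
            (w.valuation (ringClassField K ι n)).IsEquiv ((v.exists_spectralValuation).choose.comap
              (((closureEmb (K := K) (v.adicCompletion K)).restrictScalars ℚ).comp (e.restrictScalars ℚ) :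
                ringClassField K ι n →+* AlgebraicClosure (v.adicCompletion K))) →
            ∀ P, φ P = cv v hqv ⟨Eemb v n e P, hmem v hqv hn hqn e P⟩ := by
    intro n hn hqn w hw
    haveI := (finiteDimensional_and_isGalois_ringClassField hK ι hn).1
    haveI := (finiteDimensional_and_isGalois_ringClassField hK ι hn).2
    set v₀ := w.under (𝓞 K) with hv₀def
    have hqv₀ : ((q : ℕ) : 𝓞 K) ∈ v₀.asIdeal := hunder w hw
    obtain ⟨e₀, he₀⟩ := exists_algHom_isEquiv_of_under_eq (v₀.exists_spectralValuation).choose_spec w rfl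
    refine ⟨(cv v₀ hqv₀).comp ((Eemb v₀ n e₀).codRestrict (Dom v₀ hqv₀) (hmem v₀ hqv₀ hn hqn e₀)), ?_⟩
    intro v hqv hvw e he P
    subst hvw
    -- the two embeddings `e₀`, `e` cut out the same place: they are `Γ_{K_v}`-conjugate
    obtain ⟨t, ht⟩ := exists_resGal_apply_eq_of_isEquiv (w.under (𝓞 K)).exists_spectralValuation.choose_spec e₀ e he₀ he
    have hPt : Eemb (w.under (𝓞 K)) n e P = t • Eemb (w.under (𝓞 K)) n e₀ P := by
      rw [hEemb, hEemb]
      exact pointsMap_map_eq_smul_of_forall_apply_eq W e₀ e ht P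
    obtain ⟨hσP, hval⟩ := hGal (w.under (𝓞 K)) hqv t (Eemb (w.under (𝓞 K)) n e₀ P) (hmem _ hqv hn hqn e₀ P)
    rw [AddMonoidHom.comp_apply]
    have e1 : (⟨Eemb (w.under (𝓞 K)) n e P, hmem _ hqv hn hqn e P⟩ : Dom (w.under (𝓞 K)) hqv) =
        ⟨t • Eemb (w.under (𝓞 K)) n e₀ P, hσP⟩ := Subtype.ext hPt
    rw [e1, hval]
    rfl
  choose φ hφspec using hφ
  -- §2 the family
  refine ⟨fun n w ↦ if h : n ≠ 0 ∧ ¬ q ∣ n ∧ ((q : ℕ) : 𝓞 (ringClassField K ι n)) ∈ w.asIdeal then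
      φ n h.1 h.2.1 w h.2.2 else 0, ?_, ?_, ?_⟩
  · -- (K1) the kernel is `E₀(K[n])_w`
    intro n hn hqn w hw P
    haveI := (finiteDimensional_and_isGalois_ringClassField hK ι hn).1
    haveI := (finiteDimensional_and_isGalois_ringClassField hK ι hn).2
    beta_reduce
    rw [dif_pos ⟨hn, hqn, hw⟩]
    set v := w.under (𝓞 K) with hvdef
    have hqv : ((q : ℕ) : 𝓞 K) ∈ v.asIdeal := hunder w hw
    obtain ⟨e, he⟩ := exists_algHom_isEquiv_of_under_eq (v.exists_spectralValuation).choose_spec w rfl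
    rw [hφspec n hn hqn w hw v hqv rfl e he P, hker]
    obtain ⟨hmin, -, -⟩ := splitPlace_localData W hK hq2 hs v hqv
    rw [hEemb]
    exact pointsMap_map_mem_E0Receptacle_iff W v (v.exists_spectralValuation).choose_spec hmin e he P
  · -- (K2) compatibility with `K[n₀] → K[n]`
    intro n n₀ hn hqn hd f hf w₀ hw₀
    have hn₀ : n₀ ≠ 0 := by
      rintro rfl
      exact hn (Nat.eq_zero_of_zero_dvd hd)
    have hqn₀ : ¬ q ∣ n₀ := fun h ↦ hqn (h.trans hd)
    haveI := (finiteDimensional_and_isGalois_ringClassField hK ι hn).1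
    haveI := (finiteDimensional_and_isGalois_ringClassField hK ι hn).2
    haveI := (finiteDimensional_and_isGalois_ringClassField hK ι hn₀).1
    haveI := (finiteDimensional_and_isGalois_ringClassField hK ι hn₀).2
    set v := w₀.under (𝓞 K) with hvdef
    have hqv : ((q : ℕ) : 𝓞 K) ∈ v.asIdeal := hunder w₀ hw₀
    have hw₀spec := (v.exists_spectralValuation).choose_spec
    obtain ⟨e₀, he₀⟩ := exists_algHom_isEquiv_of_under_eq hw₀spec w₀ rfl
    -- `f` is `K`-linear
    have hfK : ∀ x : K, f (algebraMap K (ringClassField K ι n₀) x) = algebraMap K (ringClassField K ι n) x := by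
      intro x
      apply Subtype.ext
      rw [hf, coe_algebraMap_ringClassField, coe_algebraMap_ringClassField]
    let fK : ringClassField K ι n₀ →ₐ[K] ringClassField K ι n := { toRingHom := f.toRingHom, commutes' := hfK }
    have hfKf : ∀ x, fK x = f x := fun _ ↦ rfl
    -- extend `e₀` along `f`
    letI algF : Algebra (ringClassField K ι n₀) (ringClassField K ι n) := fK.toRingHom.toAlgebra
    haveI : IsScalarTower K (ringClassField K ι n₀) (ringClassField K ι n) :=
      IsScalarTower.of_algebraMap_eq fun x ↦ (fK.commutes x).symm
    letI algE : Algebra (ringClassField K ι n₀) (AlgebraicClosure K) := e₀.toRingHom.toAlgebra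
    haveI : IsScalarTower K (ringClassField K ι n₀) (AlgebraicClosure K) :=
      IsScalarTower.of_algebraMap_eq fun x ↦ (e₀.commutes x).symm
    haveI : Algebra.IsAlgebraic (ringClassField K ι n₀) (ringClassField K ι n) :=
      Algebra.IsAlgebraic.tower_top (K := K) (L := ringClassField K ι n₀) (A := ringClassField K ι n)
    let et0 : ringClassField K ι n →ₐ[ringClassField K ι n₀] AlgebraicClosure K := IsAlgClosed.lift
    let et : ringClassField K ι n →ₐ[K] AlgebraicClosure K := et0.restrictScalars K
    have het : ∀ x, et (f x) = e₀ x := fun x ↦ by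
      change et0 (algebraMap (ringClassField K ι n₀) (ringClassField K ι n) x) = algebraMap _ (AlgebraicClosure K) x
      exact et0.commutes x
    -- the place of `K[n]` cut out by `et`
    obtain ⟨w, hwe, hwN⟩ := Literature.NumberTheory.EllipticCurves.exists_heightOneSpectrum_isEquiv_comap hw₀spec
      (((closureEmb (K := K) (v.adicCompletion K)).restrictScalars ℚ).comp (et.restrictScalars ℚ) :
        ringClassField K ι n →+* AlgebraicClosure (v.adicCompletion K))
    have hw : ((q : ℕ) : 𝓞 (ringClassField K ι n)) ∈ w.asIdeal := hwN q hqv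
    have hvw : w.under (𝓞 K) = v := under_eq_of_isEquiv hw₀spec et hwe
    refine ⟨w, hw, fun P ↦ ?_⟩
    beta_reduce
    rw [dif_pos ⟨hn, hqn, hw⟩, dif_pos ⟨hn₀, hqn₀, hw₀⟩, hφspec n hn hqn w hw v hqv hvw et hwe,
      hφspec n₀ hn₀ hqn₀ w₀ hw₀ v hqv rfl e₀ he₀]
    congr 1
    apply Subtype.ext
    change Eemb v n et (Affine.Point.map (W' := W) f P) = Eemb v n₀ e₀ P
    have hcomp : (et.restrictScalars ℚ).comp f = e₀.restrictScalars ℚ := AlgHom.ext fun x ↦ het x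
    rw [hEemb, hEemb, Affine.Point.map_map, hcomp]
  · -- (K3) covariance under `𝒢_n`
    intro n hn hqn τ w w' hτ hww' P
    haveI := (finiteDimensional_and_isGalois_ringClassField hK ι hn).1
    haveI := (finiteDimensional_and_isGalois_ringClassField hK ι hn).2
    -- `τ` as a `K`-automorphism (kept opaque)
    obtain ⟨τK, hτK⟩ : ∃ τK : ringClassField K ι n ≃ₐ[K] ringClassField K ι n, ∀ x, τK x = τ x :=
      ⟨{ τ with commutes' := (mem_ringClassGal_iff_forall_apply_algebraMap ι n τ).mp hτ }, fun _ ↦ rfl⟩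
    have hτKsymm : ∀ x, τK.symm x = τ.symm x := fun x ↦
      τK.injective (by rw [AlgEquiv.apply_symm_apply, hτK, AlgEquiv.apply_symm_apply])
    have hwK : w = τK • w' := by
      refine HeightOneSpectrum.ext ?_
      rw [hww', HeightOneSpectrum.smul_asIdeal]
      ext x
      rw [Ideal.mem_pointwise_smul_iff_inv_smul_mem, Ideal.mem_pointwise_smul_iff_inv_smul_mem]
      have hx : (τ⁻¹ • x : 𝓞 (ringClassField K ι n)) = τK⁻¹ • x := by
        apply Subtype.ext
        change τ.symm (x : ringClassField K ι n) = τK.symm (x : ringClassField K ι n)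
        rw [hτKsymm]
      rw [hx]
    have hcompτ : (τ : ringClassField K ι n →ₐ[ℚ] ringClassField K ι n) =
        ((τK : ringClassField K ι n →ₐ[K] ringClassField K ι n).restrictScalars ℚ) :=
      AlgHom.ext fun x ↦ (hτK x).symm
    beta_reduce
    by_cases hw' : ((q : ℕ) : 𝓞 (ringClassField K ι n)) ∈ w'.asIdeal
    · -- `q ∈ w` as well
      have hw : ((q : ℕ) : 𝓞 (ringClassField K ι n)) ∈ w.asIdeal := by
        rw [hwK]
        have := (HeightOneSpectrum.smul_mem_smul_asIdeal_iff τK w' ((q : ℕ) : 𝓞 (ringClassField K ι n))).mpr hw'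
        rwa [show τK • ((q : ℕ) : 𝓞 (ringClassField K ι n)) = q from by
          rw [← MulSemiringAction.toRingHom_apply, map_natCast]] at this
      rw [dif_pos ⟨hn, hqn, hw⟩, dif_pos ⟨hn, hqn, hw'⟩]
      set v := w'.under (𝓞 K) with hvdef
      have hqv : ((q : ℕ) : 𝓞 K) ∈ v.asIdeal := hunder w' hw'
      have hvw : w.under (𝓞 K) = v := by rw [hwK, HeightOneSpectrum.under_algEquiv_smul]
      have hw₀spec := (v.exists_spectralValuation).choose_spec
      obtain ⟨e, he⟩ := exists_algHom_isEquiv_of_under_eq hw₀spec w hvw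
      -- `e ∘ τ` cuts out `τ⁻¹ w = w'`
      have he' := isEquiv_comap_comp_algEquiv e he τK
      rw [hwK, inv_smul_smul] at he'
      rw [hφspec n hn hqn w hw v hqv hvw e he,
        hφspec n hn hqn w' hw' v hqv hvdef.symm
          (e.comp (τK : ringClassField K ι n →ₐ[K] ringClassField K ι n)) he']
      congr 1
      apply Subtype.ext
      change Eemb v n e (pointGalHom W (ringClassField K ι n) τ P) =
        Eemb v n (e.comp (τK : ringClassField K ι n →ₐ[K] ringClassField K ι n)) P
      have hcomp : (e.restrictScalars ℚ).comp (τ : ringClassField K ι n →ₐ[ℚ] ringClassField K ι n) =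
          (e.comp (τK : ringClassField K ι n →ₐ[K] ringClassField K ι n)).restrictScalars ℚ := by
        rw [hcompτ]; rfl
      rw [hEemb, hEemb, pointGalHom_apply, Affine.Point.map_map, hcomp]
    · -- `q ∉ w'`, hence `q ∉ w`: both sides are `0`
      have hw : ((q : ℕ) : 𝓞 (ringClassField K ι n)) ∉ w.asIdeal := by
        rw [hwK]
        intro h
        apply hw'
        have := (HeightOneSpectrum.smul_mem_smul_asIdeal_iff τK w' ((q : ℕ) : 𝓞 (ringClassField K ι n))).mp
        apply this
        rwa [show τK • ((q : ℕ) : 𝓞 (ringClassField K ι n)) = q from by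
          rw [← MulSemiringAction.toRingHom_apply, map_natCast]]
      rw [dif_neg (fun h ↦ hw h.2.2), dif_neg (fun h ↦ hw' h.2.2)]
      rfl

end Summit.BirchSwinnertonDyer.BirchSwinnertonDyer.Theorems.TateComponent

end
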